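import Literature.NumberTheory.ModularForms.CohenEisensteinCoefficients
import Literature.NumberTheory.EllipticCurves.HalfIntegralWeightForms
import HarnessLib

/-!
# Cohen 1975, Theorem 3.1: the Cohen–Eisenstein series `H_r = Σ H(r, N) qᴺ` is a modular form of weight
# `r + 1/2` on `Γ₀(4)` (`r ≥ 2`)

Topic `Literature/NumberTheory/ModularForms` (one file for §3 of the source, D-0064). A STATEMENT-ONLY named
fact (no proof is claimed), in the tree's own vocabulary of modular forms of half-integral weight:
Shimura's space `M_{k/2}(N, χ)` is `Literature.NumberTheory.EllipticCurves.ModularForms.halfIntModularForms k N χ`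
(`HalfIntegralWeightForms.lean`: holomorphic on `ℍ`, theta-automorphic `f(γz) θ(z)^k = χ(d) θ(γz)^k f(z)` on
`Γ₀(N)`, Shimura's cusp condition at every cusp), its `q`-expansion coefficients are `qCoeffs`
(Mathlib's period-`1` `UpperHalfPlane.qExpansion 1`), and Cohen's numbers `H(r, N) ∈ ℚ` are
`Literature.NumberTheory.ModularForms.CohenEisenstein.cohenH r N` (`CohenEisensteinCoefficients.lean`, Cohen §2).

H. Cohen, *Sums involving the values at negative integers of L-functions of quadratic characters*, Math.
Ann. 217 (1975) 271–285, **Theorem 3.1**: for every integer `r ≥ 2` the function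
`H_r(z) = Σ_{N ≥ 0} H(r, N) qᴺ` (`q = e^{2πiz}`) is a modular form of weight `r + 1/2` on `Γ₀(4)` — in
Shimura's notation `H_r ∈ M_{2r+1}(4, χ₀)` with `χ₀` the trivial character modulo `4` (weight `(2r+1)/2`,
automorphy factor `j(γ, z)^{2r+1}`, `j(γ, z) = θ(γz)/θ(z)`). The primary source is not held by the cell at the
time of writing; the statement is transcribed from the VERBATIM restatement in the held secondary source
A. Ito, Acta Arith. 168 (2015) = arXiv:1212.1392, §3, Proposition 3.2: «(Cohen, [Co75]) If
`F_𝔯(z) := Σ_{N=0}^∞ H(𝔯, N) qᴺ`, then `F_𝔯(z) ∈ M_{𝔯+1/2}(Γ₀(4), χ₀)`, where `q := e^{2πiz}` and `χ₀` denotes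
the trivial character modulo `4`» (there `𝔯 > 1`). Also Koblitz, GTM 97, Ch. IV §2–§3 (Prop. 6:
`H_{k/2} = ζ(1−2λ)(E_{k/2} + (1 + i^k) 2^{−k/2} F_{k/2}) ∈ M_{k/2}(Γ̃₀(4))`, `k = 2λ + 1 ≥ 5`, with these
coefficients).

Formalisation: «`Σ_N H(r,N) qᴺ` is a modular form in `M_{(2r+1)/2}(4, 1)`» is stated as the existence of a
member `H` of `halfIntModularForms (2r+1) 4 1` whose `q`-expansion coefficients are the `H(r, N)`; since every
member is the sum of its `q`-expansion (`hasSum_qCoeffs`), such an `H` IS Cohen's `H_r`, so this is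
equivalent to the printed statement and introduces no new definition. The case `r = 1` (Zagier's
non-holomorphic Eisenstein series of weight `3/2`) is excluded, as in the source.

USED BY: the line `eisenstein-resource-bdp-line` on crux `PrintCFram.BottomClassIndexLawFiveLe` (BSD cell
bsd-print-cfram), stub `stub_cutForm` ((CutForm⁶)): with `…Theorems.PrintCFram.HalfIntegralBridge`
(`H · θ(Q²·)^p ∈ ModularForm (Gamma1 (4Q²)) (r + (p+1)/2)` for `H ∈ M_{(2r+1)/2}(4, χ)`) this fact yields the
integral-weight modular form whose periodic cut reduces to `G·T`. No proof is claimed here (proving it needs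
the Eisenstein series of half-integral weight on `Γ₀(4)` and their Fourier coefficients, Cohen §3 /
Koblitz IV §2–3, not in the tree).

## References

* [Cohen1975] H. Cohen, *Sums involving the values at negative integers of L-functions of quadratic
  characters*, Math. Ann. 217 (1975) 271–285, Thm. 3.1 (doi:10.1007/bf01436180; not held).
* [Ito2015] A. Ito, *On certain infinite families of imaginary quadratic fields whose Iwasawa λ-invariant
  is equal to 1*, Acta Arith. 168 (2015) = arXiv:1212.1392, §3, Prop. 3.2 (held `paper:arxiv-1212.1392`,
  p. 9: Cohen's theorem verbatim).
* [Shimura1973HalfIntegral] G. Shimura, *On modular forms of half integral weight*, Ann. of Math. 97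
  (1973) 440–481, §1 (the spaces `M_k(N, χ)`).
* N. Koblitz, *Introduction to Elliptic Curves and Modular Forms*, GTM 97, Ch. IV §2–§3, Prop. 6 (not held).
-/

noncomputable section

open UpperHalfPlane

namespace Literature.NumberTheory.ModularForms.Cohen1975

open Literature.NumberTheory.EllipticCurves.ModularForms
open Literature.NumberTheory.ModularForms.CohenEisenstein

/-- **Cohen 1975, Theorem 3.1** (named fact, statement only): for every integer `r ≥ 2`, the
Cohen–Eisenstein series `H_r(z) = Σ_{N ≥ 0} H(r, N) qᴺ` is a modular form of weight `r + 1/2` on `Γ₀(4)`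
with trivial character — i.e. there is a member `H` of Shimura's space `M_{(2r+1)/2}(4, χ₀)`
(`halfIntModularForms (2r+1) 4 1`: holomorphic, `H(γz) θ(z)^{2r+1} = θ(γz)^{2r+1} H(z)` on `Γ₀(4)`, bounded at
every cusp) whose `q`-expansion coefficients are Cohen's numbers, `qCoeffs H N = H(r, N)` for all `N`
(so `H = Σ H(r,N) qᴺ = H_r` by `hasSum_qCoeffs`). Verbatim (Ito 2015, Prop. 3.2, restating Cohen): «If
`F_𝔯(z) := Σ_{N=0}^∞ H(𝔯, N) qᴺ`, then `F_𝔯(z) ∈ M_{𝔯+1/2}(Γ₀(4), χ₀)`, where `q := e^{2πiz}` and `χ₀` denotes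
the trivial character modulo `4`.» [cite: Cohen1975, Thm. 3.1] [cite: Ito2015, Prop. 3.2 (arXiv:1212.1392 p. 9)] -/
def thm31_cohenSeries_mem_halfIntModularForms : Prop :=
  ∀ r : ℕ, 2 ≤ r →
    ∃ H : ℍ → ℂ, H ∈ halfIntModularForms (2 * r + 1) 4 1 ∧
      ∀ N : ℕ, qCoeffs H N = ((cohenH r N : ℚ) : ℂ)

end Literature.NumberTheory.ModularForms.Cohen1975

end
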